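import Mathlib
import Summits.MatrixMultiplication.MatrixMultiplication.Theorems.SnSubsetDichotomyNoThresholdSubsetTriplePlancherelGrowthDefs
import Summits.MatrixMultiplication.MatrixMultiplication.Theorems.SnSubsetDichotomyNoThresholdSubsetTripleShapeBeforeDefs
import Summits.MatrixMultiplication.MatrixMultiplication.Theorems.SnSubsetDichotomyNoThresholdSubsetTriplePlancherelStepDefs

/-!
# The Lyapunov process frozen at the exit from the `3√n`-box

Line `klr-graded-polynomial-method`, crux `SnSubsetDichotomy.NoThresholdSubsetTriple` (stmt-MatrixMultiplication-8302),
stub `stopped_process_exists` ((Q)-programme of the MODEL theorem, lead c7).  For the Plancherel growth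
`ν_t(ω) = shapeBefore (ω.2.2).1 t` (the shape of the entries `< t` of the second tableau of a same-shape pair
`ω : TableauPair n`) and ANY shape functional `V : Finset (ℕ × ℕ) → ℝ`, the process `t ↦ V(ν_t)` FROZEN at the first
time the shape leaves the box `{x | x.1 < 3√n ∧ x.2 < 3√n}` exists as a pointwise object: `W_0 = V ∅`, and
`W_{t+1} = V(ν_{t+1})` if `ν_t` is boxed, `W_{t+1} = W_t` otherwise.  Its five listed properties:

* `W_0 = V ∅`;
* on `{ν_t boxed}` the increment of `W` is that of `V(ν)` — because the prefix shapes increase, a boxed `ν_t` has a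
  boxed past, so the process was never frozen before `t` and `W_t = V(ν_t)`;
* off `{ν_t boxed}` the increment vanishes;
* `W_t = V(ν_s)` for some `s ≤ t` (the freezing time capped at `t`);
* `W_t` is `ℱ_t`-adapted in the strongest (pointwise) sense: it factors through the prefix key `prefixKey n t`
  (cells of the entries `< t`), because `ν_s` is a function of the key at time `s`
  (`ν_s = ⋃ k, (prefixKey n s ω k).toFinset`), which is a function of the key at any later time (`prefixKey_of_le`).

The construction is carried out abstractly (`stopped_frozen_process_exists`: any shapes `ν`, keys, box predicate with
boxed shapes having boxed pasts, shapes read off from keys, earlier keys read off from later keys) and then specialised.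
-/

open MeasureTheory ProbabilityTheory
open scoped BigOperators ENNReal
open Literature.RepresentationTheory.FiniteGroups (addableNodes IsAddableNode TableauPair)
open Literature.NumberTheory.DiophantineGeometry (StdFilling)

namespace Summit.MatrixMultiplication.MatrixMultiplication.Theorems

open PlancherelStep PlancherelGrowth

set_option linter.dupNamespace false in
/-- **Abstract freezing.** Shapes `ν t ω`, keys `key t ω`, a box predicate such that a boxed shape has a boxed
predecessor, shapes read off from keys (`hν`) and the time-`t` key read off from the time-`(t+1)` key (`hkey`).  Then the
process `W 0 = V e`, `W (t+1) ω = if boxed (ν t ω) then V (ν (t+1) ω) else W t ω` has the increments of `V ∘ ν` on boxed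
shapes and zero increments off them, is always some earlier `V (ν s ω)`, and factors through the key at every time. [folklore] -/
private theorem stopped_frozen_process_exists {Ω K S : Type*} (ν : ℕ → Ω → S) (key : ℕ → Ω → K)
    (boxed : S → Prop) (V : S → ℝ) (e : S) (shapeOfKey : K → S) (trunc : ℕ → K → K)
    (h0 : ∀ ω, ν 0 ω = e) (hmono : ∀ t ω, boxed (ν (t + 1) ω) → boxed (ν t ω))
    (hν : ∀ t ω, ν t ω = shapeOfKey (key t ω)) (hkey : ∀ t ω, key t ω = trunc t (key (t + 1) ω)) :
    ∃ W : ℕ → Ω → ℝ,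
      (∀ ω, W 0 ω = V e) ∧
      (∀ (t : ℕ) (ω : Ω), boxed (ν t ω) → W (t + 1) ω - W t ω = V (ν (t + 1) ω) - V (ν t ω)) ∧
      (∀ (t : ℕ) (ω : Ω), ¬ boxed (ν t ω) → W (t + 1) ω - W t ω = 0) ∧
      (∀ (t : ℕ) (ω : Ω), ∃ s : ℕ, s ≤ t ∧ W t ω = V (ν s ω)) ∧
      (∀ t : ℕ, ∃ F : K → ℝ, W t = F ∘ key t) := by
  classical
  -- the frozen process, by recursion on time
  obtain ⟨W, hW0, hWs⟩ : ∃ W : ℕ → Ω → ℝ, (∀ ω, W 0 ω = V e) ∧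
      ∀ t ω, W (t + 1) ω = if boxed (ν t ω) then V (ν (t + 1) ω) else W t ω :=
    ⟨fun t => Nat.rec (motive := fun _ => Ω → ℝ) (fun _ => V e)
      (fun t Wt ω => if boxed (ν t ω) then V (ν (t + 1) ω) else Wt ω) t, fun _ => rfl, fun _ _ => rfl⟩
  -- while the shape is boxed the process is `V (ν t ω)`: a boxed shape has a boxed predecessor
  have hinv : ∀ t ω, boxed (ν t ω) → W t ω = V (ν t ω) := by
    intro t ω h
    cases t with
    | zero => rw [hW0, h0]
    | succ t => rw [hWs, if_pos (hmono t ω h)]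
  refine ⟨W, hW0, fun t ω h => ?_, fun t ω h => ?_, fun t ω => ?_, fun t => ?_⟩
  · rw [hWs, if_pos h, hinv t ω h]
  · rw [hWs, if_neg h, sub_self]
  · induction t with
    | zero => exact ⟨0, le_rfl, by rw [hW0, h0]⟩
    | succ t ih =>
      obtain ⟨s, hs, hW⟩ := ih
      by_cases h : boxed (ν t ω)
      · exact ⟨t + 1, le_rfl, by rw [hWs, if_pos h]⟩
      · exact ⟨s, Nat.le_succ_of_le hs, by rw [hWs, if_neg h, hW]⟩
  · induction t with
    | zero => exact ⟨fun _ => V e, funext fun ω => hW0 ω⟩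
    | succ t ih =>
      obtain ⟨F, hF⟩ := ih
      -- the time-`(t+1)` key determines the time-`t` key, hence `ν t`, `W t` and the branch taken
      refine ⟨fun κ => if boxed (shapeOfKey (trunc t κ)) then V (shapeOfKey κ) else F (trunc t κ), ?_⟩
      funext ω
      simp only [Function.comp_apply]
      rw [hWs, ← hkey, ← hν, ← hν, hF, Function.comp_apply]

set_option linter.dupNamespace false in
/-- No entry is `< 0`: the growth starts at the empty shape. [folklore] -/
private theorem stopped_shapeBefore_zero {n : ℕ} (f : Fin n → ℕ × ℕ) : shapeBefore f 0 = ∅ := by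
  ext x
  simp [shapeBefore]

set_option linter.dupNamespace false in
/-- The prefix shapes increase: an entry `< t` is an entry `< t + 1`. [folklore] -/
private theorem stopped_mem_shapeBefore_succ {n : ℕ} {f : Fin n → ℕ × ℕ} {t : ℕ} {x : ℕ × ℕ}
    (hx : x ∈ shapeBefore f t) : x ∈ shapeBefore f (t + 1) := by
  simp only [shapeBefore, Finset.mem_image, Finset.mem_filter, Finset.mem_univ, true_and] at hx ⊢
  obtain ⟨j, hj, rfl⟩ := hx
  exact ⟨j, Nat.lt_succ_of_lt hj, rfl⟩

-- adapted from the private lemma `shapeBefore_eq_biUnion_prefixKey` of the tree file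
-- `SnSubsetDichotomyNoThresholdSubsetTriplePairMeasureBasic.lean`
set_option linter.dupNamespace false in
/-- The prefix shape is a function of the prefix key: the cells of the entries `< t` of the second tableau are the
values `some _` of `prefixKey n t ω`. [folklore] -/
private theorem stopped_shapeBefore_eq_biUnion_prefixKey {n : ℕ} (t : ℕ) (ω : TableauPair n) :
    shapeBefore (ω.2.2).1 t = Finset.univ.biUnion fun k => (prefixKey n t ω k).toFinset := by
  ext x
  simp only [shapeBefore, Finset.mem_image, Finset.mem_filter, Finset.mem_univ, true_and, Finset.mem_biUnion,
    Option.mem_toFinset, Option.mem_def, prefixKey, Option.ite_none_right_eq_some, Option.some.injEq]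

set_option linter.dupNamespace false in
/-- **The process `V(ν_t)` frozen at the exit from the `3√n`-box** (stub `stopped_process_exists` of line
`klr-graded-polynomial-method`, crux `SnSubsetDichotomy.NoThresholdSubsetTriple`).  For every `n` and every shape
functional `V` there is a process `W : ℕ → TableauPair n → ℝ` with `W 0 = V ∅`; whose increment `W (t+1) − W t` is
`V(ν_{t+1}) − V(ν_t)` when the prefix shape `ν_t = shapeBefore (ω.2.2).1 t` lies in the box `x.1, x.2 < 3√n` and `0`
otherwise; which at every time equals `V(ν_s)` for some `s ≤ t`; and which is adapted to the prefix filtration in the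
pointwise sense `W t = F ∘ prefixKey n t`.  (`W (t+1) = V(ν_{t+1})` if `ν_t` is boxed, `W t` otherwise; a boxed
shape has a boxed past since the prefix shapes increase.) [folklore] -/
theorem stopped_process_exists : ∀ (n : ℕ) (V : Finset (ℕ × ℕ) → ℝ),
    ∃ W : ℕ → TableauPair n → ℝ,
      (∀ ω, W 0 ω = V ∅) ∧
      (∀ (t : ℕ) (ω : TableauPair n),
        (∀ x ∈ shapeBefore (ω.2.2).1 t, (x.1 : ℝ) < 3 * Real.sqrt n ∧ (x.2 : ℝ) < 3 * Real.sqrt n) →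
          W (t + 1) ω - W t ω = V (shapeBefore (ω.2.2).1 (t + 1)) - V (shapeBefore (ω.2.2).1 t)) ∧
      (∀ (t : ℕ) (ω : TableauPair n),
        ¬ (∀ x ∈ shapeBefore (ω.2.2).1 t, (x.1 : ℝ) < 3 * Real.sqrt n ∧ (x.2 : ℝ) < 3 * Real.sqrt n) →
          W (t + 1) ω - W t ω = 0) ∧
      (∀ (t : ℕ) (ω : TableauPair n), ∃ s : ℕ, s ≤ t ∧ W t ω = V (shapeBefore (ω.2.2).1 s)) ∧
      (∀ t : ℕ, ∃ F : (Fin n → Option (ℕ × ℕ)) → ℝ, W t = F ∘ prefixKey n t) := by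
  intro n V
  exact stopped_frozen_process_exists (fun t (ω : TableauPair n) => shapeBefore (ω.2.2).1 t) (prefixKey n)
    (fun Y => ∀ x ∈ Y, (x.1 : ℝ) < 3 * Real.sqrt n ∧ (x.2 : ℝ) < 3 * Real.sqrt n) V ∅
    (fun κ => Finset.univ.biUnion fun k => (κ k).toFinset) (fun t κ k => if k.1 < t then κ k else none)
    (fun ω => stopped_shapeBefore_zero (ω.2.2).1)
    (fun t ω h x hx => h x (stopped_mem_shapeBefore_succ hx))
    (fun t ω => stopped_shapeBefore_eq_biUnion_prefixKey t ω)
    (fun t ω => prefixKey_of_le (Nat.le_succ t) ω)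

end Summit.MatrixMultiplication.MatrixMultiplication.Theorems
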